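import Literature.AlgebraicGeometry.Frobenioids.IsometricPreStepsPullback
import Literature.AnabelianGeometry.EtaleTheta.RemarksSec3Proofs
import HarnessLib

/-!
# Frobenioids II, §0 p. 5: "any Frobenioid over a base category of weakly indissectible (resp.
# strongly dissectible; weakly dissectible) type is itself of that type" — PROVED for abstract
# Frobenioids ([FrdI] Def. 1.3), by the printed argument

Mochizuki, *The geometry of Frobenioids II: poly-Frobenioids*, Kyushu J. Math. **62** (2008) 401–460,
§0, paragraph **Categories**, kurims text p. 5 l. 20–24 [cite: MochizukiFrdII2008, §0 p.5]:
"Observe that by considering appropriate pre-steps and pull-back morphisms as in [Mzk5], Definition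
1.3, (i), (b), (c), it follows immediately that [the underlying category of] any Frobenioid over a
base category of weakly indissectible (respectively, strongly dissectible; weakly dissectible) type is
itself of weakly indissectible (respectively, strongly dissectible; weakly dissectible) type."

PROOF-ONLY file (theorems only; abc-iut cell, seat abc-iut-f-031), companion of
`ModelFrobenioidDissectionTypes.lean` (the same observation for the model Frobenioids of [FrdI] Thm. 5.2
(i)).  Here the underlying category `C` of an ABSTRACT Frobenioid `F : C → F_Φ` over `D`
(`PreFrobenioid.IsFrobenioid F`, [FrdI] Def. 1.3, `Frobenioid.lean`) is treated, following print:

* `IsFrobenioid.isNonemptyObj` — every object of a Frobenioid is non-initial ([FrdI] Def. 1.3 (i)(a):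
  there is a Frobenius-trivial object `Y`, whose Frobenius endomorphism of degree `2` would absorb the
  unique arrow from an initial object, contradicting `deg_Fr(φ ∘ ψ) = deg_Fr(φ) · deg_Fr(ψ)` in `ℕ_{≥1}`);
* `IsFrobenioid.exists_over_pair` — "appropriate pre-steps and pull-back morphisms": two arrows
  `W → Base(X₀)`, `W → Base(X₁)` of `D` lift along Def. 1.3 (i)(c) to pull-back morphisms
  `Zᵢ → Xᵢ` with `Base(Zᵢ) ≅ W` (`PreFrobenioid.exists_isPullbackMorphism_over`, abc-iut-L1-t1), and
  Def. 1.3 (i)(b) realises the base-isomorphism `Base(Z₀) ≅ Base(Z₁)` by pre-steps `Z → Z₀`, `Z → Z₁`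
  out of a common object;
* the three clauses `isOfWeaklyIndissectibleType_of_base` (no hypothesis on `D` beyond the type),
  `isOfStronglyDissectibleType_of_base`, `isOfWeaklyDissectibleType_of_base` (for `D` totally
  epimorphic — the standing hypothesis on the base of a Frobenioid, [FrdI] §0 / Def. 1.3 — which makes
  every object of a base of dissectible type non-initial, `IsTotallyEpimorphic.isNonemptyObj_of_isOf…`,
  abc-iut-w5-d135), and their conjunction `dissectionTypes_of_base`.

Elementary; nothing here bears on the disputed [IUTchIII] Cor. 3.12 or takes a side; no statement of
the paper is strengthened (print's "any Frobenioid" has a connected, totally epimorphic base by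
[FrdI] Def. 1.3).
-/

namespace Literature.AlgebraicGeometry.Frobenioids

namespace PreFrobenioid

namespace IsFrobenioid

open CategoryTheory CategoryTheory.Limits Opposite

universe w v v' u u'

variable {D : Type u} [Category.{v} D] {Φ : Dᵒᵖ ⥤ CommMonCat.{w}}
  {C : Type u'} [Category.{v'} C] {F : C ⥤ ElemFrobenioid Φ}

/-- In a Frobenioid every object is non-initial ("nonempty", [FrdI] §0 p. 15): by Def. 1.3 (i)(a)
there is a Frobenius-trivial object `Y`; if `A` were initial, the unique arrow `f : A → Y` would
satisfy `f ≫ ζ_Y(2) = f`, whence `deg_Fr(f) · 2 = deg_Fr(f)` in `ℕ_{≥1}`.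
[cite: MochizukiFrdI2008, Def. 1.3(i) p.24] -/
theorem isNonemptyObj (hF : IsFrobenioid F) (A : C) : IsNonemptyObj A := by
  refine ⟨fun hI => ?_⟩
  obtain ⟨Y, ⟨ζ, hζ⟩, -⟩ := hF.i_a (baseObj F A)
  have h2 : hI.to Y ≫ (ζ 2 : Y ⟶ Y) = hI.to Y := hI.hom_ext _ _
  have hdeg : degFr F (hI.to Y) * 2 = degFr F (hI.to Y) * 1 := by
    rw [mul_one, ← (hζ 2).1, ← degFr_comp, h2]
  exact absurd (mul_left_cancel hdeg) (by decide)

/-- "Appropriate pre-steps and pull-back morphisms as in [Mzk5], Definition 1.3, (i), (b), (c)":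
two arrows `f₀ : W → Base(X₀)`, `f₁ : W → Base(X₁)` of the base category are dominated by a common
object `Z` of the Frobenioid — pull-back morphisms `Zᵢ → Xᵢ` over `fᵢ` with `Base(Zᵢ) ≅ W` ((i)(c)),
and pre-steps `Z → Z₀`, `Z → Z₁` realising `Base(Z₀) ≅ W ≅ Base(Z₁)` ((i)(b)).
[cite: MochizukiFrdII2008, §0 p.5] -/
theorem exists_over_pair (hF : IsFrobenioid F) (X₀ X₁ : C) {W : D} (f₀ : W ⟶ baseObj F X₀)
    (f₁ : W ⟶ baseObj F X₁) : ∃ Z : C, Nonempty (Z ⟶ X₀) ∧ Nonempty (Z ⟶ X₁) := by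
  obtain ⟨Z₀, φ₀, ι₀, -, -⟩ := exists_isPullbackMorphism_over hF X₀ f₀
  obtain ⟨Z₁, φ₁, ι₁, -, -⟩ := exists_isPullbackMorphism_over hF X₁ f₁
  obtain ⟨Z, ψ₀, ψ₁, -, -, -⟩ := hF.i_b Z₀ Z₁ (ι₀ ≪≫ ι₁.symm)
  exact ⟨Z, ⟨ψ₀ ≫ φ₀⟩, ⟨ψ₁ ≫ φ₁⟩⟩

/-- **[FrdII] §0 p. 5, first clause:** the underlying category of a Frobenioid over a base category of
weakly indissectible type is of weakly indissectible type (no further hypothesis): a strongly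
dissecting pair `Xᵢ → A` would project to a strongly dissecting pair `Base(Xᵢ) → Base(A)`, since two
arrows `W → Base(X₀)`, `W → Base(X₁)` are dominated by a common (non-initial) object of `C`
(`exists_over_pair`, `isNonemptyObj`). [cite: MochizukiFrdII2008, §0 p.5] -/
theorem isOfWeaklyIndissectibleType_of_base (hF : IsFrobenioid F)
    (hD : IsOfWeaklyIndissectibleType D) : IsOfWeaklyIndissectibleType C := by
  refine ⟨fun A => ?_⟩
  rintro ⟨X, φ, -, hXsd⟩
  have key : ∀ W : D, (W ⟶ baseObj F (X 0)) → (W ⟶ baseObj F (X 1)) → False := by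
    intro W f₀ f₁
    obtain ⟨Z, hZ₀, hZ₁⟩ := hF.exists_over_pair (X 0) (X 1) f₀ f₁
    exact hXsd (show (0 : Fin 2) ≠ 1 by decide) (hF.isNonemptyObj Z) ⟨hZ₀, hZ₁⟩
  refine hD.isWeaklyIndissectible (baseObj F A)
    ⟨fun i => baseObj F (X i), fun i => Base F (φ i), fun i => ⟨fun hI => ?_⟩, ?_⟩
  · exact key _ (hI.to _) (hI.to _)
  · rintro i j hij W - ⟨⟨fi⟩, ⟨fj⟩⟩
    fin_cases i <;> fin_cases j
    · exact hij rfl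
    · exact key W fi fj
    · exact key W fj fi
    · exact hij rfl

/-- **[FrdII] §0 p. 5, second clause:** the underlying category of a Frobenioid over a totally
epimorphic base category of strongly dissectible type is of strongly dissectible type: a strongly
dissecting pair `gᵢ : Yᵢ → Base(A)` lifts along Def. 1.3 (i)(c) to pull-back morphisms `φᵢ : Xᵢ → A`
with `Base(Xᵢ) ≅ Yᵢ` over `Base(A)`; the `Xᵢ` are non-initial (`isNonemptyObj`), and arrows
`Z → Xᵢ`, `Z → Xⱼ` project to arrows out of the non-initial object `Base(Z)`.
[cite: MochizukiFrdII2008, §0 p.5] -/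
theorem isOfStronglyDissectibleType_of_base (hF : IsFrobenioid F) (hDe : IsTotallyEpimorphic D)
    (hD : IsOfStronglyDissectibleType D) : IsOfStronglyDissectibleType C := by
  refine ⟨fun A => ?_⟩
  obtain ⟨Y, g, -, hYsd⟩ := hD.isStronglyDissectible (baseObj F A)
  choose X φ ι hφ using fun i => exists_isPullbackMorphism_over hF A (g i)
  refine ⟨X, φ, fun i => hF.isNonemptyObj (X i), ?_⟩
  rintro i j hij Z - ⟨⟨ψi⟩, ⟨ψj⟩⟩
  exact hYsd hij (hDe.isNonemptyObj_of_isOfStronglyDissectibleType hD (baseObj F Z))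
    ⟨⟨Base F ψi ≫ (ι i).hom⟩, ⟨Base F ψj ≫ (ι j).hom⟩⟩

/-- **[FrdII] §0 p. 5, third clause:** the underlying category of a Frobenioid over a totally
epimorphic base category of weakly dissectible type is of weakly dissectible type: lift a weakly
dissecting pair `gᵢ : Yᵢ → Base(A)` to pull-back morphisms `φᵢ : Xᵢ → A` with `ιᵢ : Base(Xᵢ) ≅ Yᵢ`,
`Base(φᵢ) = ιᵢ ≫ gᵢ`; an equality `ψᵢ ≫ φᵢ = ψⱼ ≫ φⱼ` in `C` projects to
`(Base(ψᵢ) ≫ ιᵢ) ≫ gᵢ = (Base(ψⱼ) ≫ ιⱼ) ≫ gⱼ` out of the non-initial `Base(Z)`.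
[cite: MochizukiFrdII2008, §0 p.5] -/
theorem isOfWeaklyDissectibleType_of_base (hF : IsFrobenioid F) (hDe : IsTotallyEpimorphic D)
    (hD : IsOfWeaklyDissectibleType D) : IsOfWeaklyDissectibleType C := by
  refine ⟨fun A => ?_⟩
  obtain ⟨Y, g, -, hYwd⟩ := hD.isWeaklyDissectible (baseObj F A)
  choose X φ ι hφ using fun i => exists_isPullbackMorphism_over hF A (g i)
  refine ⟨X, φ, fun i => hF.isNonemptyObj (X i), ?_⟩
  intro i j hij Z _ ψi ψj heq
  refine hYwd hij (hDe.isNonemptyObj_of_isOfWeaklyDissectibleType hD (baseObj F Z))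
    (Base F ψi ≫ (ι i).hom) (Base F ψj ≫ (ι j).hom) ?_
  rw [Category.assoc, Category.assoc, ← (hφ i).2, ← (hφ j).2, ← base_comp, ← base_comp, heq]

/-- **[FrdII] §0 p. 5 l. 20–24, as printed (three clauses),** for the underlying category `C` of a
Frobenioid `C → F_Φ` over a totally epimorphic base `D` ([FrdI] Def. 1.3).
[cite: MochizukiFrdII2008, §0 p.5] -/
theorem dissectionTypes_of_base (hF : IsFrobenioid F) (hDe : IsTotallyEpimorphic D) :
    (IsOfWeaklyIndissectibleType D → IsOfWeaklyIndissectibleType C) ∧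
    (IsOfStronglyDissectibleType D → IsOfStronglyDissectibleType C) ∧
    (IsOfWeaklyDissectibleType D → IsOfWeaklyDissectibleType C) :=
  ⟨hF.isOfWeaklyIndissectibleType_of_base, hF.isOfStronglyDissectibleType_of_base hDe,
    hF.isOfWeaklyDissectibleType_of_base hDe⟩

/-! ### "Nonempty [i.e., non-initial]" is vacuous in a Frobenioid (appended by abc-iut-f-031 gen 2)

[FrdII] §0 p. 5 qualifies the objects in its dissection vocabulary as "nonempty [i.e., non-initial]"
and calls a functor *totally non-initial* when all its values are non-initial. Since every object of a
Frobenioid is non-initial (`isNonemptyObj`), in [the underlying category of] a Frobenioid these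
qualifiers are automatic: there is no initial object at all, every functor into `C` is totally
non-initial, and the strongly / weakly dissecting conditions reduce to their domination clauses. -/

/-- The underlying category of a Frobenioid has NO initial object (every object is non-initial,
`isNonemptyObj`; an initial object `⊥_ C` would be "empty" in the sense of [FrdI] §0).
[cite: MochizukiFrdI2008, Def. 1.3(i) p.24] -/
theorem not_hasInitial (hF : IsFrobenioid F) : ¬ HasInitial C :=
  fun _ => (hF.isNonemptyObj (⊥_ C)).false initialIsInitial

/-- No object of a Frobenioid is initial (pointwise form of `not_hasInitial`).
[cite: MochizukiFrdI2008, Def. 1.3(i) p.24] -/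
theorem isInitial_isEmpty (hF : IsFrobenioid F) (A : C) : IsEmpty (IsInitial A) :=
  hF.isNonemptyObj A

/-- Every functor with values in [the underlying category of] a Frobenioid is *totally non-initial*
in the sense of [FrdII] §0 p. 5 (`IsTotallyNonInitial`). [cite: MochizukiFrdII2008, §0 p.5] -/
theorem isTotallyNonInitial (hF : IsFrobenioid F) {E : Type*} [Category E] (G : E ⥤ C) :
    IsTotallyNonInitial G :=
  fun A => hF.isNonemptyObj (G.obj A)

/-- In a Frobenioid a family `{φᵢ : Aᵢ → A}` *strongly dissects* `A` iff no two distinct members are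
dominated by a common object — the "non-initial" provisos of [FrdII] §0 p. 5 being automatic.
[cite: MochizukiFrdII2008, §0 p.5] -/
theorem stronglyDissects_iff (hF : IsFrobenioid F) {ι : Type*} {A : C} {X : ι → C}
    (φ : ∀ i, X i ⟶ A) :
    StronglyDissects φ ↔
      ∀ ⦃i j : ι⦄, i ≠ j → ∀ ⦃B : C⦄, ¬ (Nonempty (B ⟶ X i) ∧ Nonempty (B ⟶ X j)) :=
  ⟨fun h _ _ hij B => h.2 hij (hF.isNonemptyObj B),
    fun h => ⟨fun i => hF.isNonemptyObj (X i), fun _ _ hij B _ => @h _ _ hij B⟩⟩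

/-- In a Frobenioid a family `{φᵢ : Aᵢ → A}` *weakly dissects* `A` iff no two distinct members are
equalised by arrows out of a common object — the "non-initial" provisos of [FrdII] §0 p. 5 being
automatic. [cite: MochizukiFrdII2008, §0 p.5] -/
theorem weaklyDissects_iff (hF : IsFrobenioid F) {ι : Type*} {A : C} {X : ι → C}
    (φ : ∀ i, X i ⟶ A) :
    WeaklyDissects φ ↔
      ∀ ⦃i j : ι⦄, i ≠ j → ∀ ⦃B : C⦄ (ψi : B ⟶ X i) (ψj : B ⟶ X j), ψi ≫ φ i ≠ ψj ≫ φ j :=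
  ⟨fun h _ _ hij B ψi ψj => h.2 hij (hF.isNonemptyObj B) ψi ψj,
    fun h => ⟨fun i => hF.isNonemptyObj (X i), fun _ _ hij _ _ ψi ψj => h hij ψi ψj⟩⟩

/-- In a Frobenioid, `A` is strongly dissectible iff it receives a pair of arrows whose domains are
not dominated by a common object. [cite: MochizukiFrdII2008, §0 p.5] -/
theorem isStronglyDissectible_iff (hF : IsFrobenioid F) (A : C) :
    IsStronglyDissectible A ↔
      ∃ (X : Fin 2 → C) (_ : ∀ i, X i ⟶ A),
        ∀ ⦃i j : Fin 2⦄, i ≠ j → ∀ ⦃B : C⦄, ¬ (Nonempty (B ⟶ X i) ∧ Nonempty (B ⟶ X j)) := by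
  refine ⟨fun ⟨X, φ, h⟩ => ⟨X, φ, (hF.stronglyDissects_iff φ).1 h⟩, fun ⟨X, φ, h⟩ => ?_⟩
  exact ⟨X, φ, (hF.stronglyDissects_iff φ).2 h⟩

/-- In a Frobenioid, `A` is weakly dissectible iff it receives a pair of arrows that are not
equalised by any pair of arrows out of a common object. [cite: MochizukiFrdII2008, §0 p.5] -/
theorem isWeaklyDissectible_iff (hF : IsFrobenioid F) (A : C) :
    IsWeaklyDissectible A ↔
      ∃ (X : Fin 2 → C) (φ : ∀ i, X i ⟶ A),
        ∀ ⦃i j : Fin 2⦄, i ≠ j → ∀ ⦃B : C⦄ (ψi : B ⟶ X i) (ψj : B ⟶ X j), ψi ≫ φ i ≠ ψj ≫ φ j := by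
  refine ⟨fun ⟨X, φ, h⟩ => ⟨X, φ, (hF.weaklyDissects_iff φ).1 h⟩, fun ⟨X, φ, h⟩ => ?_⟩
  exact ⟨X, φ, (hF.weaklyDissects_iff φ).2 h⟩

end IsFrobenioid

end PreFrobenioid

end Literature.AlgebraicGeometry.Frobenioids
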